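import Summits.NavierStokesRegularity.TurbBounds.ShearSpecEntries
import Mathlib.Data.Real.Basic
import Mathlib.Algebra.BigOperators.Ring.Finset
import Mathlib.Algebra.BigOperators.Group.Finset.Sigma
import Mathlib.Data.Rat.BigOperators
import HarnessLib

/-!
# Quadratic / bilinear forms of the SPEC §2 tables on real coefficient vectors (Legendre–Galerkin bridge, algebraic half)

Cell `turb-bounds` (pub-turb), shear lane, pub-turb-shear gen 6 (2026-08-22); v2 lane. With `bform M n x y = Σ_{i,j<n} x_i·M[i][j]·y_j` (entries cast to `ℝ`)
and the row functionals `lin M L n x = Σ_{j<L} M[n][j]·x_j` (so `lin (d1Rows N P) L2 n c = a_n`, `lin (d0cRows N P) L2 n c = b_n` are the Legendre coefficients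
of `W′`, `W` produced by the ladders from those of `W″`), the closed-form entries of `ShearSpecEntries` give:
* `qform_q1Tab` : `cᵀQ1c = A·Σ_{j<L2} w_j c_j² + 8·Σ_{n≤N+1} w_n a_n² + C·Σ_{n≤N} w_n b_n²` — SPEC 2.4 / FW16 (B3) as an identity of forms;
* `bform_eTab`  : `xᵀE⁽ᵖ⁾y = Σ_{n,m'} K⁽ᵖ⁾[n][m']·b_n(x)·a_{m'}(y)` — SPEC 2.5 (the finite part of the cross term on the index set `S`);
* `qform_diagMat`, `qform_g0Tab`, `qform_h0Tab`, `qform_rTab` — SPEC 2.6–2.7 (`cᵀH1c = Σ h1_j c_j²`, `cᵀG0c = φ_N a_N² + φ'_{N+1} a_{N+1}²`, `H0 = G0 + μH1`, `R = D[(δ/2)H0 + H1/(2δ)]`).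
What remains for the bridge proper (v2, later files): Parseval + the integration ladder (tree: `LegendreCoeffs`), `Λ = ∫P_lP_mP_n` (cert's `LegendreTriple`),
the tails (`ShearTailSeq`), the projection `c = Aω` bookkeeping, density. PURE FINSET ALGEBRA.
HONEST FRAMING: rigorous bounds for the stated PDE and boundary conditions; no claim about physical turbulence beyond the bound.
-/

set_option linter.style.longLine false

namespace Summit.NavierStokesRegularity.TurbBounds.ShearSpecPieces

open Finset

/-- The bilinear form of a row-list table on real vectors (indices `< n`). -/
def bform (M : List (List ℚ)) (n : ℕ) (x y : ℕ → ℝ) : ℝ := ∑ i ∈ range n, ∑ j ∈ range n, x i * (get2 M i j : ℝ) * y j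

/-- The quadratic form. -/
def qform (M : List (List ℚ)) (n : ℕ) (x : ℕ → ℝ) : ℝ := bform M n x x

/-- The row-`n` linear functional `(M x)_n = Σ_{j<L} M[n][j]·x_j`. -/
def lin (M : List (List ℚ)) (L n : ℕ) (x : ℕ → ℝ) : ℝ := ∑ j ∈ range L, (get2 M n j : ℝ) * x j

/-! ### Finset algebra -/

/-- A rank-one form: `Σ_{i,j<L} x_i·(c·d_i·e_j)·y_j = c·(Σ d_i x_i)·(Σ e_j y_j)`. -/
theorem sum_sum_rank1 (c : ℝ) (d e x y : ℕ → ℝ) (L : ℕ) :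
    ∑ i ∈ range L, ∑ j ∈ range L, x i * (c * d i * e j) * y j = c * (∑ i ∈ range L, d i * x i) * (∑ j ∈ range L, e j * y j) := by
  rw [show c * (∑ i ∈ range L, d i * x i) * (∑ j ∈ range L, e j * y j)
      = c * ((∑ i ∈ range L, d i * x i) * (∑ j ∈ range L, e j * y j)) by ring, Finset.sum_mul_sum]
  simp only [Finset.mul_sum]
  exact Finset.sum_congr rfl fun i _ => Finset.sum_congr rfl fun j _ => by ring

/-- A Gram-type form: `Σ_{i,j<L} x_i·(Σ_{n<m} a_n d_{ni} e_{nj})·y_j = Σ_{n<m} a_n·(Σ_i d_{ni} x_i)·(Σ_j e_{nj} y_j)`. -/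
theorem sum_sum_gram (a : ℕ → ℝ) (d e : ℕ → ℕ → ℝ) (x y : ℕ → ℝ) (m L : ℕ) :
    ∑ i ∈ range L, ∑ j ∈ range L, x i * (∑ n ∈ range m, a n * d n i * e n j) * y j
      = ∑ n ∈ range m, a n * (∑ i ∈ range L, d n i * x i) * (∑ j ∈ range L, e n j * y j) := by
  have h1 : ∑ i ∈ range L, ∑ j ∈ range L, x i * (∑ n ∈ range m, a n * d n i * e n j) * y j
      = ∑ i ∈ range L, ∑ j ∈ range L, ∑ n ∈ range m, x i * (a n * d n i * e n j) * y j :=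
    Finset.sum_congr rfl fun i _ => Finset.sum_congr rfl fun j _ => by rw [Finset.mul_sum, Finset.sum_mul]
  have h2 : ∑ i ∈ range L, ∑ j ∈ range L, ∑ n ∈ range m, x i * (a n * d n i * e n j) * y j
      = ∑ n ∈ range m, ∑ i ∈ range L, ∑ j ∈ range L, x i * (a n * d n i * e n j) * y j := by
    rw [Finset.sum_congr rfl fun i _ => Finset.sum_comm, Finset.sum_comm]
  rw [h1, h2]
  exact Finset.sum_congr rfl fun n _ => sum_sum_rank1 (a n) (d n) (e n) x y L

/-- A diagonal form: `Σ_{i,j<L} x_i·[i = j]v_i·y_j = Σ_{i<L} v_i x_i y_i`. -/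
theorem sum_sum_diag (v x y : ℕ → ℝ) (L : ℕ) :
    ∑ i ∈ range L, ∑ j ∈ range L, x i * (if i = j then v i else 0) * y j = ∑ i ∈ range L, v i * x i * y i := by
  refine Finset.sum_congr rfl fun i hi => ?_
  rw [Finset.sum_eq_single i]
  · rw [if_pos rfl]; ring
  · intro j _ hji; rw [if_neg (Ne.symm hji)]; ring
  · intro h; exact absurd hi h

/-! ### the forms of the SPEC tables -/

/-- Casting helper: the real entry of the ladders. -/
theorem lin_eq (M : List (List ℚ)) (L n : ℕ) (x : ℕ → ℝ) : lin M L n x = ∑ j ∈ range L, (get2 M n j : ℝ) * x j := rfl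

/-- **SPEC 2.4 as an identity of quadratic forms**: `cᵀ Q1 c = A Σ_{j<L2} w_j c_j² + 8 Σ_{n<N+2} w_n a_n² + C Σ_{n<N+1} w_n b_n²`
with `a_n = (D1 c)_n`, `b_n = (D0c c)_n` (`L2 = N+P+4`). -/
theorem qform_q1Tab (N P : ℕ) (A C : ℚ) (x : ℕ → ℝ) :
    qform (q1Tab N P A C) (N + P + 4) x
      = (A : ℝ) * ∑ j ∈ range (N + P + 4), (norm2 j : ℝ) * x j ^ 2
        + 8 * ∑ n ∈ range (N + 2), (norm2 n : ℝ) * lin (d1Rows N P) (N + P + 4) n x ^ 2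
        + (C : ℝ) * ∑ n ∈ range (N + 1), (norm2 n : ℝ) * lin (d0cRows N P) (N + P + 4) n x ^ 2 := by
  unfold qform bform
  have hentry : ∀ i ∈ range (N + P + 4), ∀ j ∈ range (N + P + 4),
      x i * (get2 (q1Tab N P A C) i j : ℝ) * x j
        = x i * (if i = j then (A : ℝ) * norm2 i else 0) * x j
          + x i * (∑ n ∈ range (N + 2), (8 * (norm2 n : ℝ)) * get2 (d1Rows N P) n i * get2 (d1Rows N P) n j) * x j
          + x i * (∑ n ∈ range (N + 1), ((C : ℝ) * norm2 n) * get2 (d0cRows N P) n i * get2 (d0cRows N P) n j) * x j := by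
    intro i hi j _
    have hi' : i < N + P + 4 := by simpa using hi
    rw [get2_q1Tab, if_congr (Iff.intro (fun h => h.2) (fun h => ⟨hi', h⟩)) rfl rfl]
    have e : ((if i = j then A * norm2 i else 0 : ℚ) : ℝ) = if i = j then (A : ℝ) * norm2 i else 0 := by split_ifs <;> simp
    push_cast
    rw [e]
    ring
  rw [Finset.sum_congr rfl fun i hi => Finset.sum_congr rfl fun j hj => hentry i hi j hj]
  simp only [Finset.sum_add_distrib]
  rw [sum_sum_diag, sum_sum_gram, sum_sum_gram]
  simp only [lin_eq]
  have e1 : ∑ i ∈ range (N + P + 4), (A : ℝ) * (norm2 i : ℝ) * x i * x i = (A : ℝ) * ∑ j ∈ range (N + P + 4), (norm2 j : ℝ) * x j ^ 2 := by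
    rw [Finset.mul_sum]; exact Finset.sum_congr rfl fun i _ => by ring
  have e2 : ∑ n ∈ range (N + 2), 8 * (norm2 n : ℝ) * (∑ i ∈ range (N + P + 4), (get2 (d1Rows N P) n i : ℝ) * x i)
        * (∑ j ∈ range (N + P + 4), (get2 (d1Rows N P) n j : ℝ) * x j)
      = 8 * ∑ n ∈ range (N + 2), (norm2 n : ℝ) * (∑ j ∈ range (N + P + 4), (get2 (d1Rows N P) n j : ℝ) * x j) ^ 2 := by
    rw [Finset.mul_sum]; exact Finset.sum_congr rfl fun n _ => by ring
  have e3 : ∑ n ∈ range (N + 1), (C : ℝ) * (norm2 n : ℝ) * (∑ i ∈ range (N + P + 4), (get2 (d0cRows N P) n i : ℝ) * x i)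
        * (∑ j ∈ range (N + P + 4), (get2 (d0cRows N P) n j : ℝ) * x j)
      = (C : ℝ) * ∑ n ∈ range (N + 1), (norm2 n : ℝ) * (∑ j ∈ range (N + P + 4), (get2 (d0cRows N P) n j : ℝ) * x j) ^ 2 := by
    rw [Finset.mul_sum]; exact Finset.sum_congr rfl fun n _ => by ring
  rw [e1, e2, e3]

/-- **SPEC 2.5 as an identity of bilinear forms**: `xᵀ E⁽ᵖ⁾ y = Σ_{n<N+P+2} Σ_{m'<N+P+3} K⁽ᵖ⁾[n][m']·b_n(x)·a_{m'}(y)` with `b(x) = D0c x`, `a(y) = D1 y`. -/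
theorem bform_eTab (N P p : ℕ) (x y : ℕ → ℝ) :
    bform (eTab N P p) (N + P + 4) x y
      = ∑ n ∈ range (N + P + 2), ∑ m' ∈ range (N + P + 3),
          (get2 (kTab N P p) n m' : ℝ) * lin (d0cRows N P) (N + P + 4) n x * lin (d1Rows N P) (N + P + 4) m' y := by
  unfold bform
  -- entry: E[i][j] = Σ_n D0c[n][i] Σ_m' K[n][m'] D1[m'][j] = Σ_n Σ_m' K[n][m'] D0c[n][i] D1[m'][j]
  have hentry : ∀ i j, x i * (get2 (eTab N P p) i j : ℝ) * y j
      = ∑ n ∈ range (N + P + 2), x i * (∑ m' ∈ range (N + P + 3),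
          (get2 (kTab N P p) n m' : ℝ) * get2 (d0cRows N P) n i * get2 (d1Rows N P) m' j) * y j := by
    intro i j
    rw [get2_eTab]
    push_cast
    rw [Finset.mul_sum, Finset.sum_mul]
    refine Finset.sum_congr rfl fun n _ => ?_
    have e : ∑ m' ∈ range (N + P + 3), (get2 (kTab N P p) n m' : ℝ) * get2 (d0cRows N P) n i * get2 (d1Rows N P) m' j
        = (get2 (d0cRows N P) n i : ℝ) * ∑ m' ∈ range (N + P + 3), (get2 (kTab N P p) n m' : ℝ) * get2 (d1Rows N P) m' j := by
      rw [Finset.mul_sum]; exact Finset.sum_congr rfl fun m' _ => by ring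
    rw [e]
  rw [Finset.sum_congr rfl fun i _ => Finset.sum_congr rfl fun j _ => hentry i j]
  -- swap Σ_i Σ_j Σ_n → Σ_n Σ_i Σ_j
  rw [Finset.sum_congr rfl fun i _ => Finset.sum_comm, Finset.sum_comm]
  refine Finset.sum_congr rfl fun n _ => ?_
  rw [sum_sum_gram]
  rfl

/-- **A diagonal table's form**: `xᵀ diag(v) x = Σ_{i<L} v_i x_i²` (any `L`; entries beyond `|v|` are `0`). -/
theorem qform_diagMat (v : List ℚ) (L : ℕ) (x : ℕ → ℝ) :
    qform (diagMat v) L x = ∑ i ∈ range L, (v.getD i 0 : ℝ) * x i ^ 2 := by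
  unfold qform bform
  have hentry : ∀ i j, x i * (get2 (diagMat v) i j : ℝ) * x j = x i * (if i = j then (v.getD i 0 : ℝ) else 0) * x j := by
    intro i j; rw [get2_diagMat]; split_ifs <;> simp
  simp_rw [hentry]
  rw [sum_sum_diag]
  exact Finset.sum_congr rfl fun i _ => by ring

/-- **`cᵀ G0 c = φ_N·a_N² + 4/((2N+3)²(2N+5))·a_{N+1}²** (`a = D1 c`; SPEC 2.6, ours). -/
theorem qform_g0Tab (N P : ℕ) (x : ℕ → ℝ) :
    qform (g0Tab N P) (N + P + 4) x
      = 4 / ((2 * (N : ℝ) + 1) ^ 2 * (2 * (N : ℝ) + 3)) * lin (d1Rows N P) (N + P + 4) N x ^ 2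
        + 4 / ((2 * (N : ℝ) + 3) ^ 2 * (2 * (N : ℝ) + 5)) * lin (d1Rows N P) (N + P + 4) (N + 1) x ^ 2 := by
  unfold qform bform
  have hentry : ∀ i j, x i * (get2 (g0Tab N P) i j : ℝ) * x j
      = x i * (4 / ((2 * (N : ℝ) + 1) ^ 2 * (2 * (N : ℝ) + 3)) * get2 (d1Rows N P) N i * get2 (d1Rows N P) N j) * x j
        + x i * (4 / ((2 * (N : ℝ) + 3) ^ 2 * (2 * (N : ℝ) + 5)) * get2 (d1Rows N P) (N + 1) i * get2 (d1Rows N P) (N + 1) j) * x j := by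
    intro i j; rw [get2_g0Tab]; push_cast; ring
  simp_rw [hentry]
  simp only [Finset.sum_add_distrib]
  rw [sum_sum_rank1, sum_sum_rank1]
  simp only [lin_eq]
  ring

/-- Linearity of `qform` in the table, from an entrywise identity. -/
theorem qform_of_entry (M A B : List (List ℚ)) (a b : ℝ) (L : ℕ) (x : ℕ → ℝ)
    (h : ∀ i j, (get2 M i j : ℝ) = a * get2 A i j + b * get2 B i j) :
    qform M L x = a * qform A L x + b * qform B L x := by
  unfold qform bform
  rw [Finset.mul_sum, Finset.mul_sum, ← Finset.sum_add_distrib]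
  refine Finset.sum_congr rfl fun i _ => ?_
  rw [Finset.mul_sum, Finset.mul_sum, ← Finset.sum_add_distrib]
  refine Finset.sum_congr rfl fun j _ => ?_
  rw [h]; ring

/-- **`cᵀ H0 c = cᵀ G0 c + μ·cᵀ H1 c`** (SPEC 2.6, ours). -/
theorem qform_h0Tab (N P : ℕ) (x : ℕ → ℝ) :
    qform (h0Tab N P) (N + P + 4) x = qform (g0Tab N P) (N + P + 4) x + (mu N : ℝ) * qform (diagMat (h1Diag N P)) (N + P + 4) x := by
  have h := qform_of_entry (h0Tab N P) (g0Tab N P) (diagMat (h1Diag N P)) 1 (mu N : ℝ) (N + P + 4) x (fun i j => by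
    rw [get2_h0Tab, get2_diagMat]; push_cast; ring)
  rw [h]; ring

/-- **`cᵀ R c = D·[(δ/2)·cᵀH0c + cᵀH1c/(2δ)]`** (SPEC 2.7). -/
theorem qform_rTab (N P : ℕ) (D : ℚ) (x : ℕ → ℝ) :
    qform (rTab N P D) (N + P + 4) x
      = (D : ℝ) * ((delta N : ℝ) / 2 * qform (h0Tab N P) (N + P + 4) x + 1 / (2 * (delta N : ℝ)) * qform (diagMat (h1Diag N P)) (N + P + 4) x) := by
  have h := qform_of_entry (rTab N P D) (h0Tab N P) (diagMat (h1Diag N P)) ((D : ℝ) * ((delta N : ℝ) / 2)) ((D : ℝ) * (1 / (2 * (delta N : ℝ))))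
    (N + P + 4) x (fun i j => by rw [get2_rTab, get2_diagMat]; push_cast; ring)
  rw [h]; ring

end Summit.NavierStokesRegularity.TurbBounds.ShearSpecPieces
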